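import Mathlib
import Literature.NumberTheory.LFunctions.RosserSchoenfeldMertensFirstConstant
import HarnessLib

/-!
# Crux `SystemMomentDeficit` (stmt-Parity-11326), line `Ideator3Sketch`: `stub_primeWindow`

Stub (Mertens prime window) of the line skeleton
`Summit.Parity.BatemanHorn.Cruxes.SystemMomentDeficit.Ideator3Sketch` for the crux
`Summit.Parity.BatemanHorn.Theses.AlmostPrimeZeros.SystemMomentDeficit`.

There is an absolute constant `C` with
`Σ_{t < p ≤ x prime} 1/p ≤ (log x − log t + C)/log t` for all naturals `2 ≤ t ≤ x`.

Proof.  For a prime `p > t ≥ 2`, `1/p = (log p/p)·(1/log p) ≤ (log p/p)/log t`, so the left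
side is at most `(1/log t)·Σ_{t < p ≤ x} log p/p = (1/log t)(Σ_{p ≤ x} log p/p − Σ_{p ≤ t} log p/p)`,
and the two-sided Mertens first theorem
(`Literature.NumberTheory.LFunctions.abs_sum_primesLE_log_div_sub_log_sub_rosserSchoenfeldE_le`
with exponent `0`: `|Σ_{p ≤ y} log p/p − log y − E| ≤ K` for `y ≥ 2`) bounds the difference by
`log x − log t + 2K`.  Everything is [folklore]; no definitions are introduced.
-/

namespace Summit.Parity.BatemanHorn.Cruxes.SystemMomentDeficit.Ideator3Sketch

open Finset

/-- Mertens' first theorem, two-sided, at natural arguments: there is `K` with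
`|Σ_{p ≤ m} log p/p − log m − E| ≤ K` for all naturals `m ≥ 2`
(`abs_sum_primesLE_log_div_sub_log_sub_rosserSchoenfeldE_le 0`). [folklore] -/
private theorem abs_sum_primesLE_log_div_sub_log_le :
    ∃ K : ℝ, ∀ m : ℕ, 2 ≤ m →
      |(∑ p ∈ Nat.primesLE m, Real.log p / p) - Real.log m -
          Literature.NumberTheory.LFunctions.rosserSchoenfeldE| ≤ K := by
  obtain ⟨K, hK⟩ :=
    Literature.NumberTheory.LFunctions.abs_sum_primesLE_log_div_sub_log_sub_rosserSchoenfeldE_le 0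
  refine ⟨K, fun m hm => ?_⟩
  have h := hK m (by exact_mod_cast hm)
  rwa [Nat.floor_natCast, pow_zero, div_one] at h

/-- The primes of `(t, x]` are the primes `≤ x` minus the primes `≤ t`. [folklore] -/
private theorem primesLE_filter_lt_eq_sdiff (t x : ℕ) :
    (Nat.primesLE x).filter (fun p => t < p) = Nat.primesLE x \ Nat.primesLE t := by
  ext p
  simp only [Finset.mem_filter, Finset.mem_sdiff, Nat.mem_primesLE, not_and', not_le]
  constructor
  · rintro ⟨h, htp⟩
    exact ⟨h, fun _ => htp⟩
  · rintro ⟨h, htp⟩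
    exact ⟨h, htp h.2⟩

/-- **Mertens prime window.** There is an absolute constant `C` with
`Σ_{t < p ≤ x prime} 1/p ≤ (log x − log t + C)/log t` for all naturals `2 ≤ t ≤ x`
(termwise `1/p ≤ (log p/p)/log t`, then the two-sided Mertens first theorem at `x` and at `t`).
[folklore] -/
theorem stub_primeWindow :
    ∃ C : ℝ, ∀ t x : ℕ, 2 ≤ t → t ≤ x →
      ∑ p ∈ (Nat.primesLE x).filter (fun p => t < p), (1 : ℝ) / (p : ℝ) ≤
        (Real.log x - Real.log t + C) / Real.log t := by
  obtain ⟨K, hK⟩ := abs_sum_primesLE_log_div_sub_log_le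
  refine ⟨2 * K, fun t x ht htx => ?_⟩
  have ht1 : (1 : ℝ) < t := by exact_mod_cast ht
  have hlogt : 0 < Real.log t := Real.log_pos ht1
  have hx := (abs_le.mp (hK x (ht.trans htx))).2
  have ht' := (abs_le.mp (hK t ht)).1
  have h1 : ∑ p ∈ (Nat.primesLE x).filter (fun p => t < p), (1 : ℝ) / (p : ℝ) ≤
      ∑ p ∈ (Nat.primesLE x).filter (fun p => t < p), Real.log p / p / Real.log t := by
    refine Finset.sum_le_sum fun p hp => ?_
    obtain ⟨-, htp⟩ := Finset.mem_filter.mp hp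
    have htp' : (t : ℝ) < p := by exact_mod_cast htp
    have hp0 : (0 : ℝ) < p := by linarith
    have hlog : Real.log t ≤ Real.log p := Real.log_le_log (by linarith) htp'.le
    rw [div_div, div_le_div_iff₀ hp0 (mul_pos hp0 hlogt)]
    nlinarith
  calc ∑ p ∈ (Nat.primesLE x).filter (fun p => t < p), (1 : ℝ) / (p : ℝ)
      ≤ ∑ p ∈ (Nat.primesLE x).filter (fun p => t < p), Real.log p / p / Real.log t := h1
    _ = ((∑ p ∈ Nat.primesLE x, Real.log p / p) - ∑ p ∈ Nat.primesLE t, Real.log p / p) /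
          Real.log t := by
        rw [← Finset.sum_div, primesLE_filter_lt_eq_sdiff,
          Finset.sum_sdiff_eq_sub (Nat.primesLE_mono htx)]
    _ ≤ (Real.log x - Real.log t + 2 * K) / Real.log t := by
        apply div_le_div_of_nonneg_right _ hlogt.le
        linarith

end Summit.Parity.BatemanHorn.Cruxes.SystemMomentDeficit.Ideator3Sketch
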